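import Summits.BirchSwinnertonDyer.Rank2.LevelFifteenExactSymbols
import Summits.BirchSwinnertonDyer.Rank2.RefFifteenTwoAdicLFunctionUnit
import HarnessLib

/-!
# Manin symbols on `Γ₀(15)`, VIII: the PARITY LAW of the exact descent — `n₁(c, d) mod 2` is a function of `(c, d) mod 15`;
# on `15 ∣ d` it is the quadratic character mod `5`; the dyadic symbol parity `hlaw` of `15A8` for ALL levels

Cell `bsd-rank2` (D-0036), seat `bsd-rank2-eng` GEN 9. The unit theorem `SymbolParityAtTwo.refFifteen_exists_isUnit_iwasawa_of_parity`
(eng-2 GEN 4: `u = L₂(15A8)/2 ∈ Λˣ`) carries two symbol hypotheses: `h0` (`[0]⁺ = K/8`, `K` odd — part IV) and `hlaw`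
(`[a/2ᵐ]⁺ = [0]⁺ + k/2` with `k ≡ m (mod 2)` for ALL `m` and odd `a`). Here `hlaw` is PROVED, by an induction along the exact
Euclid descent of part III whose step is a finite kernel check:

* `parityTab : Fin 15 → Fin 15 → ℤ` — a `0/1` table; **`descentF_fst_parity`**: for coprime `(c, d)` and fuel `n > |c|`,
  `(descentF n c d).1 ≡ parityTab(c mod 15, d mod 15) (mod 2)` (induction on the fuel; the step
  `F(r, −c) − sA1(cls(c,r)) + Σ_{i<j} tA1(cls(c, r+ic)) ≡ F(c, jc + r)` for all admissible residues and `j < 15` is `parity_step`,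
  by `decide`);
* **`descent_fst_parity_of_fifteen_dvd`**: for coprime `(c, d)` with `15 ∣ d`, `(descent c d).1` is odd iff `c ≡ ±2 (mod 5)` —
  the `E₁`-parity character of `Γ₀(15)` is the quadratic character modulo `5`;
* **`refFifteen_symbol_parity_law`** (`hlaw`): for every newform `f` of `[1,1,1,0,0]`, every `m` and odd `a`,
  `∃ k, [a/2ᵐ]⁺_f = [0]⁺_f + k/2 ∧ 2 ∣ k − m` (`2ᵐ ≡ ±2 (mod 5) ⟺ m` odd); with part IV's `h0` this makes
  **`refFifteen_exists_isUnit_iwasawa`: `∃ u ∈ Λˣ, ι u = ½·L₂(f, α)` UNCONDITIONAL**.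

THEOREMS + one table (`def parityTab`, data). PARTITION: none — r_an ≥ 2, summit axis S0; TWIN (D-0056): n/a. B1 honesty:
finite Manin-symbol arithmetic; nothing reads an analytic rank; no S0 motion.

References: Ju. I. Manin, *Izv. AN SSSR* 36 (1972), Thm. 1.6 [Manin1972]; J. E. Cremona, *Algorithms for modular elliptic
curves* (1997) §2.2–§2.8 [CremonaAlgorithms1997]; B. Mazur, J. Tate, J. Teitelbaum, *Invent. Math.* 84 (1986) §I.10 [MazurTateTeitelbaum1986Invent].
-/

open scoped MatrixGroups ModularForm

namespace Summit.BirchSwinnertonDyer.Rank2.LevelFifteen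

/-! ### §1 The parity table and the finite step -/

/-- The parity table `F(c mod 15, d mod 15) = n₁(c,d) mod 2` (rows `c`, columns `d`; entries on inadmissible cells are `0`).
[folklore] -/
def parityTab : Fin 15 → Fin 15 → ℤ :=
  ![![0, 0, 1, 0, 0, 0, 0, 1, 1, 0, 0, 0, 0, 1, 0],
    ![0, 0, 0, 0, 0, 0, 0, 0, 0, 0, 0, 0, 0, 0, 0],
    ![1, 1, 1, 1, 1, 1, 1, 1, 1, 1, 1, 1, 1, 1, 1],
    ![0, 0, 1, 0, 0, 0, 0, 1, 1, 0, 0, 0, 0, 1, 0],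
    ![0, 0, 0, 0, 0, 0, 0, 0, 0, 0, 0, 0, 0, 0, 0],
    ![0, 0, 1, 0, 0, 0, 1, 1, 1, 1, 0, 0, 0, 1, 0],
    ![0, 0, 1, 0, 0, 1, 0, 1, 1, 0, 1, 0, 0, 1, 0],
    ![1, 1, 1, 1, 1, 1, 1, 1, 1, 1, 1, 1, 1, 1, 1],
    ![1, 1, 1, 1, 1, 1, 1, 1, 1, 1, 1, 1, 1, 1, 1],
    ![0, 0, 1, 0, 0, 1, 0, 1, 1, 0, 1, 0, 0, 1, 0],
    ![0, 0, 1, 0, 0, 0, 1, 1, 1, 1, 0, 0, 0, 1, 0],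
    ![0, 0, 0, 0, 0, 0, 0, 0, 0, 0, 0, 0, 0, 0, 0],
    ![0, 0, 1, 0, 0, 0, 0, 1, 1, 0, 0, 0, 0, 1, 0],
    ![1, 1, 1, 1, 1, 1, 1, 1, 1, 1, 1, 1, 1, 1, 1],
    ![0, 0, 0, 0, 0, 0, 0, 0, 0, 0, 0, 0, 0, 0, 0]]

/-- `Σ_{i<j} tA1(cls(x, y + i·x))` on residues (the first coordinate of `tCorr`). [folklore] -/
def tCorrZ (x y : ZMod 15) : ℕ → ℤ
  | 0 => 0
  | j + 1 => tCorrZ x y j + tA1 (clsTab x (y + j * x))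

/-- Admissible residue pairs (Boolean test): not both `≡ 0 (mod 3)`, not both `≡ 0 (mod 5)` — the image of the coprime
pairs. [folklore] -/
def admZ (x y : ZMod 15) : Bool := !(x.val % 3 == 0 && y.val % 3 == 0) && !(x.val % 5 == 0 && y.val % 5 == 0)

/-- Unfolding of `admZ`. [folklore] -/
theorem admZ_eq_true_iff (x y : ZMod 15) :
    admZ x y = true ↔ ¬ (x.val % 3 = 0 ∧ y.val % 3 = 0) ∧ ¬ (x.val % 5 = 0 ∧ y.val % 5 = 0) := by
  simp [admZ]; tauto

/-- **The inductive step, a finite check**: for admissible `(x, y)` and `j < 15`,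
`F(y, −x) − sA1(cls(x,y)) + Σ_{i<j} tA1(cls(x, y+ix)) ≡ F(x, jx + y) (mod 2)`. [folklore] -/
theorem parity_step : ∀ (x y : ZMod 15) (j : Fin 15), admZ x y = true →
    (2 : ℤ) ∣ parityTab y (-x) - sA1 (clsTab x y) + tCorrZ x y j.val - parityTab x ((j.val : ℤ) * x + y) := by
  decide +kernel

/-! ### §2 The parity law of the exact descent -/

/-- `(tCorr c r j).1 = tCorrZ c̄ r̄ j`. [folklore] -/
theorem tCorr_fst_eq (c r : ℤ) (j : ℕ) : (tCorr c r j).1 = tCorrZ (c : ZMod 15) (r : ZMod 15) j := by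
  induction j with
  | zero => rfl
  | succ j ih =>
    simp only [tCorr, tCorrZ, Prod.fst_add, ih, clsInt]
    push_cast
    ring_nf

/-- Coprime integers have admissible residues. [folklore] -/
theorem admZ_of_isCoprime {c d : ℤ} (h : IsCoprime c d) : admZ (c : ZMod 15) (d : ZMod 15) = true := by
  rw [admZ_eq_true_iff]
  obtain ⟨u, v, huv⟩ := h
  have hcv : (((c : ZMod 15)).val : ℤ) = c % 15 := ZMod.val_intCast c
  have hdv : (((d : ZMod 15)).val : ℤ) = d % 15 := ZMod.val_intCast d
  have key : ∀ (p : ℕ), (p : ℤ) ∣ 15 → 1 < p → ¬ (((c : ZMod 15)).val % p = 0 ∧ ((d : ZMod 15)).val % p = 0) := by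
    intro p hp hp1 ⟨hc, hd⟩
    have hcp : (p : ℤ) ∣ c := by
      have h2 : (p : ℤ) ∣ (((c : ZMod 15)).val : ℤ) := by exact_mod_cast Nat.dvd_of_mod_eq_zero hc
      rw [hcv, Int.emod_def] at h2
      have h3 : (p : ℤ) ∣ 15 * (c / 15) := hp.mul_right _
      simpa using h2.add h3
    have hdp : (p : ℤ) ∣ d := by
      have h2 : (p : ℤ) ∣ (((d : ZMod 15)).val : ℤ) := by exact_mod_cast Nat.dvd_of_mod_eq_zero hd
      rw [hdv, Int.emod_def] at h2
      have h3 : (p : ℤ) ∣ 15 * (d / 15) := hp.mul_right _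
      simpa using h2.add h3
    have h1 : (p : ℤ) ∣ u * c + v * d := (hcp.mul_left u).add (hdp.mul_left v)
    rw [huv] at h1
    have := Int.eq_one_of_dvd_one (by positivity) h1
    omega
  exact ⟨key 3 ⟨5, by norm_num⟩ (by norm_num), key 5 ⟨3, by norm_num⟩ (by norm_num)⟩

/-- **Parity law of the exact descent**: for coprime `(c, d)` and fuel `n > |c|`,
`(descentF n c d).1 ≡ parityTab(c mod 15, d mod 15) (mod 2)`. [cite: Manin1972, Thm. 1.6] -/
theorem descentF_fst_parity : ∀ (n : ℕ) (c d : ℤ), IsCoprime c d → c.natAbs < n →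
    (2 : ℤ) ∣ (descentF n c d).1 - parityTab (c : ZMod 15) (d : ZMod 15)
  | 0 => by intro c d _ h; omega
  | n + 1 => by
    intro c d hcop hlt
    by_cases hc : c = 0
    · subst hc
      have hd : d = 1 ∨ d = -1 := Int.isUnit_iff.mp (isCoprime_zero_left.mp hcop)
      rcases hd with rfl | rfl
      · simp only [descentF, if_true]; decide
      · simp only [descentF, if_true]; decide
    · -- one Euclid step
      set r : ℤ := d % c with hr
      set q : ℤ := d / c with hq
      have hdqr : d = c * q + r := by
        have := Int.emod_def d c
        rw [← hr, ← hq] at this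
        linarith
      have hcr : IsCoprime c r := by
        have := hcop.add_mul_left_right (-q)
        rwa [show d + c * -q = r by rw [hdqr]; ring] at this
      have hcop' : IsCoprime r (-c) := hcr.symm.neg_right
      have hrn : r.natAbs < n := by
        have h0 : 0 ≤ r := Int.emod_nonneg d hc
        have h1 : r < (c.natAbs : ℤ) := Int.emod_lt d hc
        omega
      have IH := descentF_fst_parity n r (-c) hcop' hrn
      have IH' : (2 : ℤ) ∣ (descentF n r (-c)).1 - parityTab (r : ZMod 15) (-(c : ZMod 15)) := by
        rw [Int.cast_neg] at IH; exact IH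
      have hstep : (2 : ℤ) ∣ parityTab (r : ZMod 15) (-(c : ZMod 15)) - sA1 (clsTab (c : ZMod 15) (r : ZMod 15)) +
          tCorrZ (c : ZMod 15) (r : ZMod 15) ((q % 15).toNat) -
          parityTab (c : ZMod 15) (((((q % 15).toNat : ℕ) : ℤ) : ZMod 15) * (c : ZMod 15) + (r : ZMod 15)) :=
        parity_step (c : ZMod 15) (r : ZMod 15) ⟨((q % 15).toNat), by omega⟩ (admZ_of_isCoprime hcr)
      -- unfold the descent step
      have hdesc : (descentF (n + 1) c d).1 =
          (descentF n r (-c)).1 - sA1 (clsInt c r) + (tCorr c r ((q % 15).toNat)).1 := by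
        simp only [descentF, if_neg hc, Prod.fst_add, Prod.fst_sub, ← hr, ← hq]
      rw [hdesc, tCorr_fst_eq, clsInt]
      -- `d ≡ j·c + r (mod 15)` with `j = (q % 15).toNat`
      have hj : (((q % 15).toNat : ℕ) : ℤ) = q % 15 := Int.toNat_of_nonneg (Int.emod_nonneg q (by norm_num))
      have hqmod : (((q % 15 : ℤ)) : ZMod 15) = ((q : ℤ) : ZMod 15) := by
        have h := ZMod.intCast_mod q 15
        exact_mod_cast h
      have hd15 : ((d : ZMod 15)) = ((((q % 15).toNat : ℕ) : ℤ) : ZMod 15) * (c : ZMod 15) + (r : ZMod 15) := by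
        rw [hj, hqmod, hdqr]; push_cast; ring
      rw [hd15]
      -- combine IH and the step
      have hsum := dvd_add IH' hstep
      have e : (descentF n r (-c)).1 - sA1 (clsTab (c : ZMod 15) (r : ZMod 15)) +
            tCorrZ (c : ZMod 15) (r : ZMod 15) ((q % 15).toNat) -
            parityTab (c : ZMod 15) (((((q % 15).toNat : ℕ) : ℤ) : ZMod 15) * (c : ZMod 15) + (r : ZMod 15)) =
          ((descentF n r (-c)).1 - parityTab (r : ZMod 15) (-(c : ZMod 15))) +
          (parityTab (r : ZMod 15) (-(c : ZMod 15)) - sA1 (clsTab (c : ZMod 15) (r : ZMod 15)) +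
            tCorrZ (c : ZMod 15) (r : ZMod 15) ((q % 15).toNat) -
            parityTab (c : ZMod 15) (((((q % 15).toNat : ℕ) : ℤ) : ZMod 15) * (c : ZMod 15) + (r : ZMod 15))) := by
        ring
      rw [e]
      exact hsum

/-- `descent` has enough fuel: the parity law for `descent`. [cite: Manin1972, Thm. 1.6] -/
theorem descent_fst_parity {c d : ℤ} (h : IsCoprime c d) :
    (2 : ℤ) ∣ (descent c d).1 - parityTab (c : ZMod 15) (d : ZMod 15) :=
  descentF_fst_parity _ c d h (Nat.lt_succ_self _)

/-- On the admissible cells with `d ≡ 0 (mod 15)` the table is the quadratic character mod `5`: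
`F(x, 0) = [x ≡ ±2 (mod 5)]`. [folklore] -/
theorem parityTab_fifteen_dvd : ∀ x y : ZMod 15, admZ x y = true → y = 0 →
    parityTab x y = if x.val % 5 = 2 ∨ x.val % 5 = 3 then 1 else 0 := by
  decide

/-- **The `E₁`-parity character of `Γ₀(15)` is the quadratic character mod 5**: for coprime `(c, d)` with `15 ∣ d`,
`(descent c d).1` is odd iff `c ≡ ±2 (mod 5)`. [cite: Manin1972, Thm. 1.6] [cite: CremonaAlgorithms1997, §2.2] -/
theorem descent_fst_parity_of_fifteen_dvd {c d : ℤ} (h : IsCoprime c d) (hd : (15 : ℤ) ∣ d) :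
    (2 : ℤ) ∣ (descent c d).1 - (if c % 5 = 2 ∨ c % 5 = 3 then 1 else 0) := by
  have hp := descent_fst_parity h
  have hd0 : ((d : ZMod 15)) = 0 := (ZMod.intCast_zmod_eq_zero_iff_dvd d 15).mpr (by exact_mod_cast hd)
  have htab := parityTab_fifteen_dvd (c : ZMod 15) (d : ZMod 15) (admZ_of_isCoprime h) hd0
  rw [htab] at hp
  have hval : (((c : ZMod 15)).val : ℤ) % 5 = c % 5 := by
    rw [ZMod.val_intCast c]; exact Int.emod_emod_of_dvd c (by norm_num)
  have hc5 : (((c : ZMod 15)).val % 5 = 2 ∨ ((c : ZMod 15)).val % 5 = 3) ↔ (c % 5 = 2 ∨ c % 5 = 3) := by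
    have e : (((((c : ZMod 15)).val % 5 : ℕ)) : ℤ) = c % 5 := by push_cast; exact hval
    constructor
    · rintro (h2 | h3)
      · left; rw [← e, h2]; rfl
      · right; rw [← e, h3]; rfl
    · rintro (h2 | h3)
      · left; have : (((((c : ZMod 15)).val % 5 : ℕ)) : ℤ) = 2 := e.trans h2
        exact_mod_cast this
      · right; have : (((((c : ZMod 15)).val % 5 : ℕ)) : ℤ) = 3 := e.trans h3
        exact_mod_cast this
  by_cases hcase : c % 5 = 2 ∨ c % 5 = 3
  · rw [if_pos hcase]; rw [if_pos (hc5.mpr hcase)] at hp; exact hp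
  · rw [if_neg hcase]; rw [if_neg (fun h ↦ hcase (hc5.mp h))] at hp; exact hp

/-! ### §3 The dyadic symbol parity `hlaw` of `15A8` and the unconditional unit -/

noncomputable section

open CongruenceSubgroup Literature.NumberTheory.EllipticCurves Literature.NumberTheory.EllipticCurves.ModularForms

/-- `2ᵐ mod 5 ∈ {2, 3}` iff `m` is odd. [folklore] -/
theorem two_pow_mod_five (m : ℕ) :
    ((2 : ℤ) ^ m % 5 = 2 ∨ (2 : ℤ) ^ m % 5 = 3) ↔ ¬ 2 ∣ m := by
  have key : ∀ m : ℕ, (((2 : ℤ) ^ m % 5 = 1 ∨ (2 : ℤ) ^ m % 5 = 4) ∧ 2 ∣ m) ∨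
      (((2 : ℤ) ^ m % 5 = 2 ∨ (2 : ℤ) ^ m % 5 = 3) ∧ ¬ 2 ∣ m) := by
    intro m
    induction m with
    | zero => left; simp
    | succ m ih =>
      have e : (2 : ℤ) ^ (m + 1) = 2 * (2 : ℤ) ^ m := by ring
      rw [e]; omega
  rcases key m with ⟨h1, h2⟩ | ⟨h1, h2⟩
  · constructor
    · intro h; omega
    · intro h; exact absurd h2 h
  · exact ⟨fun _ ↦ h2, fun _ ↦ h1⟩

/-- For odd `a`: `d = 15·((15a)⁻¹ mod 2ᵐ)` and `b = (ad − 1)/2ᵐ` give `a·d − b·2ᵐ = 1`, `15 ∣ d`. [folklore] -/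
theorem exists_bezout_dyadic (m a : ℕ) (ha : Odd a) :
    ∃ b d : ℤ, (a : ℤ) * d - b * 2 ^ m = 1 ∧ (15 : ℤ) ∣ d := by
  have hcop : Nat.Coprime (15 * a) (2 ^ m) :=
    (Nat.coprime_two_right.mpr ((show Odd 15 by decide).mul ha)).pow_right m
  set t : ℕ := ((((15 * a : ℕ) : ZMod (2 ^ m)))⁻¹).val with ht
  have hdvd : (2 : ℤ) ^ m ∣ (a : ℤ) * (15 * t) - 1 := by
    have h1 := ZMod.coe_mul_inv_eq_one (15 * a) hcop
    have h2 : (((15 * a * t : ℕ)) : ZMod (2 ^ m)) = ((1 : ℕ) : ZMod (2 ^ m)) := by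
      rw [Nat.cast_mul (15 * a) t, ht, ZMod.natCast_zmod_val, h1, Nat.cast_one]
    have hmod : 15 * a * t ≡ 1 [MOD 2 ^ m] := (ZMod.natCast_eq_natCast_iff _ _ _).mp h2
    have h3 := Nat.modEq_iff_dvd.mp hmod
    rw [dvd_sub_comm] at h3
    push_cast at h3
    have e : (a : ℤ) * (15 * t) - 1 = 15 * (a : ℤ) * (t : ℤ) - 1 := by ring
    rw [e]; exact h3
  refine ⟨((a : ℤ) * (15 * t) - 1) / 2 ^ m, 15 * t, ?_, dvd_mul_right _ _⟩
  rw [Int.ediv_mul_cancel hdvd]; ring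

/-- **The dyadic symbol parity law of `15A8` (`hlaw` of `refFifteen_exists_isUnit_iwasawa_of_parity`), for ALL levels `m`**:
for every newform `f` of `[1,1,1,0,0]`, every `m` and odd `a`, `[a/2ᵐ]⁺_f = [0]⁺_f + k/2` with `k ≡ m (mod 2)`.
[cite: Manin1972, Thm. 1.6] [cite: MazurTateTeitelbaum1986Invent, §I.10] -/
theorem refFifteen_symbol_parity_law ⦃N : ℕ⦄ [NeZero N] (f : CuspForm (Gamma0 N) 2)
    (hW : IsNewformOf (⟨1, 1, 1, 0, 0⟩ : WeierstrassCurve ℚ) f) :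
    ∀ m a : ℕ, Odd a →
      ∃ k : ℤ, ratPlusSymbol f ((a : ℚ) / (2 : ℚ) ^ m) = ratPlusSymbol f 0 + (k : ℚ) / 2 ∧ (2 : ℤ) ∣ k - m := by
  obtain ⟨σ, hσ, h0, hlaw⟩ := ratPlusSymbol_refFifteen_exact f hW
  intro m a ha
  obtain ⟨b, d, hbez, h15⟩ := exists_bezout_dyadic m a ha
  have h := hlaw (a : ℤ) b ((2 : ℤ) ^ m) d hbez (by positivity) h15
  have hcast : (((a : ℤ) : ℚ) / (((2 : ℤ) ^ m : ℤ) : ℚ)) = (a : ℚ) / (2 : ℚ) ^ m := by push_cast; ring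
  rw [hcast] at h
  refine ⟨σ * (descent (2 ^ m) d).1, ?_, ?_⟩
  · rw [h, h0]
  · -- parity: `n₁ ≡ [2ᵐ ≡ ±2 (5)] ≡ m (mod 2)`
    have hcop : IsCoprime ((2 : ℤ) ^ m) d := ⟨-b, a, by linear_combination hbez⟩
    have hpar := descent_fst_parity_of_fifteen_dvd hcop h15
    have h5 := two_pow_mod_five m
    by_cases hodd : (2 : ℤ) ^ m % 5 = 2 ∨ (2 : ℤ) ^ m % 5 = 3
    · rw [if_pos hodd] at hpar
      have hm : ¬ 2 ∣ m := h5.mp hodd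
      obtain ⟨w, hw⟩ := hpar
      rcases hσ with rfl | rfl <;> omega
    · rw [if_neg hodd] at hpar
      have hm : 2 ∣ m := by by_contra hne; exact hodd (h5.mpr hne)
      obtain ⟨w, hw⟩ := hpar
      rcases hσ with rfl | rfl <;> omega

/-- **`u = L₂(15A8, α)/2` is a unit of `Λ`, UNCONDITIONALLY** (eng-2 GEN 4's `refFifteen_exists_isUnit_iwasawa_of_parity` with both
symbol hypotheses discharged: `h0` by part IV, `hlaw` by `refFifteen_symbol_parity_law`).
[cite: MazurTateTeitelbaum1986Invent, §I.10–§I.13] -/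
theorem refFifteen_exists_isUnit_iwasawa (hmin : (⟨1, 1, 1, 0, 0⟩ : WeierstrassCurve ℚ).IsGloballyMinimal)
    {N : ℕ} [NeZero N] {f : CuspForm (Gamma0 N) 2} (hW : IsNewformOf (⟨1, 1, 1, 0, 0⟩ : WeierstrassCurve ℚ) f) :
    ∃ u : IwasawaAlgebra 2, IsUnit u ∧
      iwasawaToPowerSeries 2 u = PowerSeries.C ((2 : ℚ_[2])⁻¹) *
        padicLFunction f (@unitRoot (⟨1, 1, 1, 0, 0⟩ : WeierstrassCurve ℚ) hmin 2 _ : ℚ_[2]) := by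
  obtain ⟨σ, hσ, h0, -⟩ := ratPlusSymbol_refFifteen_exact f hW
  have h0' : ∃ K : ℤ, Odd K ∧ ratPlusSymbol f 0 = (K : ℚ) / 8 := by
    refine ⟨-σ, ?_, by rw [h0]; push_cast; ring⟩
    rcases hσ with rfl | rfl <;> decide
  exact SymbolParityAtTwo.refFifteen_exists_isUnit_iwasawa_of_parity hmin hW h0' (refFifteen_symbol_parity_law f hW)

/-- **`λ(L₀) = 0` and `μ`-freeness for every integral multiple of `L₂(15A8)`, UNCONDITIONALLY** (eng-2's
`refFifteen_exists_lam_eq_zero_of_parity` discharged). [cite: MazurTateTeitelbaum1986Invent, §I.12–§I.13] -/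
theorem refFifteen_exists_lam_eq_zero (hmin : (⟨1, 1, 1, 0, 0⟩ : WeierstrassCurve ℚ).IsGloballyMinimal)
    {N : ℕ} [NeZero N] {f : CuspForm (Gamma0 N) 2} (hW : IsNewformOf (⟨1, 1, 1, 0, 0⟩ : WeierstrassCurve ℚ) f) :
    ∃ (c : ℚ) (L₀ : IwasawaAlgebra 2), L₀ ≠ 0 ∧
      iwasawaToPowerSeries 2 L₀ = PowerSeries.C (c : ℚ_[2]) *
        padicLFunction f (@unitRoot (⟨1, 1, 1, 0, 0⟩ : WeierstrassCurve ℚ) hmin 2 _ : ℚ_[2]) ∧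
      Rank1Residual.X1.MuLambda.lam L₀ = 0 ∧ Rank1Residual.X1.MuLambda.mu L₀ = 0 := by
  obtain ⟨σ, hσ, h0, -⟩ := ratPlusSymbol_refFifteen_exact f hW
  have h0' : ∃ K : ℤ, Odd K ∧ ratPlusSymbol f 0 = (K : ℚ) / 8 := by
    refine ⟨-σ, ?_, by rw [h0]; push_cast; ring⟩
    rcases hσ with rfl | rfl <;> decide
  exact SymbolParityAtTwo.refFifteen_exists_lam_eq_zero_of_parity hmin hW h0' (refFifteen_symbol_parity_law f hW)

end

end Summit.BirchSwinnertonDyer.Rank2.LevelFifteen
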